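/-
Copyright (c) 2026 the pub-hodgecm-mathlib formalisation cell (harness21).  Prover seat hodgecm-mathlib-K2E1-p08 (g4), Track B ∕ K2-LIT, h413 =
`stmt-HodgeConjecture-24833`, line `K2_E1_TraceFormulaBeta`, campaign «EIS-RANK-ONE» rung R4a, `N`-generic: continuity in `g`, joint continuity and holomorphy in `z` of the Borel
Eisenstein series of `U(J_N)` FROM a locally uniform height majorant; instance `N = 2` over a CM field UNCONDITIONAL (DEAL BY NAME K2E1-plan (g3) 2026-09-04T05:13:55Z (1), twin).
-/
import Summits.HodgeConjecture.HodgeConjecture.Theorems.K2E1BorelEisensteinRegularCMThree   -- ★ p857508 (this seat): `rpow_le_rpow_add_rpow`, the `N = 3` instances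
import Summits.HodgeConjecture.HodgeConjecture.Theorems.K2E1BorelEisensteinGodementCMTwo     -- ★ p857569 (this seat): Godement at `N = 2` over a CM field, unconditional
import HarnessLib

/-!
# K2·E1 — `K2E1BorelEisensteinRegularU`: CONTINUITY IN `g`, JOINT CONTINUITY IN `(z, g)` AND HOLOMORPHY IN `z` OF `E(φ, z)(g) = Σ_q φ(γ̃_q g)·H(γ̃_q g)^z` ON `U(J_N)` FROM A
# LOCALLY UNIFORM HEIGHT MAJORANT (any `N`, hypothesis-first) — and the `N = 2` CM instance, UNCONDITIONAL on `Re z > 1` (campaign EIS-RANK-ONE, rung R4a)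

Track B ∕ K2-LIT, crux h413 = `stmt-HodgeConjecture-24833`, route of record `HCCMUnconditional`; cell `hodgecm-mathlib`, squad K2, ENGINE E1.  Prover seat
`hodgecm-mathlib-K2E1-p08` (g4); DEAL BY NAME (K2E1-plan (g3) 05:13:55Z (1): «then the `RegularCMTwo` twin») — typed ONCE for every `N` so that `N = 2` (here) and any future
`N` are one-liners (the `N = 3` file ★ `K2E1BorelEisensteinRegularCMThree` predates this generic form).  THEOREMS ONLY (no `def`, no `instance`, no notation, no named-fact hypothesis, no
`sorry`); lane `--kind proof --supports stmt-HodgeConjecture-24833 --as helper` (count-neutral).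

THE HYPOTHESIS (what R2 delivers): `hmaj : ∀ τ > τ₀, ∀ g₀, ∃ U ∈ 𝓝 g₀, ∃ u summable, ∀ g ∈ U, ∀ q, H(γ̃_q g)^τ ≤ u q` (`τ₀ = 2ρ_H`: `2` for `U(J₃)` ★ p857478∕p857508, `1` for `U(J₂)` ★
`K2E1BorelEisensteinGodementCMTwo`).
* §1 **`exists_nhds_uniform_majorant_flatSectionU`** — ONE summable majorant of `‖f_z(γ̃_q g)‖` for `g` near `g₀` and all `z` in a strip `σ₁ ≤ Re z ≤ σ₂` (`τ₀ < σ₁ ≤ σ₂`, `‖φ‖ ≤ M`).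
* §2 **`continuous_eisensteinSeriesU_flatSectionU`** (`τ₀ < Re z`, `φ` continuous bounded ⟹ `g ↦ E(φ,z)(g)` continuous); `continuous_flatSectionU_uncurry`;
  **`continuous_eisensteinSeriesU_flatSectionU_uncurry`** (joint continuity on `{z // τ₀ < Re z} × G(𝔸)`); `differentiable_flatSectionU_apply` (each term entire);
  **`differentiableOn_eisensteinSeriesU_flatSectionU`** (`z ↦ E(φ,z)(g)` holomorphic on `{τ₀ < Re z}` for every bounded `φ` and every `g`) — all on ★ p09 `K2E1EisensteinSeriesRegularity`.
* §3 `N = 2` OVER A CM FIELD, UNCONDITIONAL (`τ₀ = 1`): **`continuous_eisensteinSeriesU_flatSectionU_cm_two`**, **`continuous_eisensteinSeriesU_flatSectionU_uncurry_cm_two`**,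
  **`differentiableOn_eisensteinSeriesU_flatSectionU_cm_two (L) (hφ) (g) : DifferentiableOn ℂ (fun z => eisensteinSeriesU (flatSectionU φ z) g) {z | 1 < z.re}`** — the 5Res rails.
[MoeglinWaldspurger1995 II.1.5 Prop.; Garrett2018 §2.8; Godement1964 §8.]
HONEST LABEL: HC_CM is proved only modulo the 7 printed citations (2 remaining named inputs: hLiu418 = `stmt-HodgeConjecture-24832`, h413 = `stmt-HodgeConjecture-24833`) until rung 0
closes; count-neutral helper, proves no printed statement, closes no socket.
-/

set_option autoImplicit false
-- the mandated namespace repeats the single-problem summit's segment (`HodgeConjecture.HodgeConjecture`)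
set_option linter.dupNamespace false

noncomputable section

open Set Filter Topology MulAction NumberField
open scoped NNReal
open Literature.NumberTheory.Automorphic Literature.NumberTheory.Automorphic.UnitaryGroup
open Summit.HodgeConjecture.HodgeConjecture.Cruxes.H413.K2E1BorelEisensteinU
open Summit.HodgeConjecture.HodgeConjecture.Cruxes.H413.K2E1BorelEisensteinGodementU3
open Summit.HodgeConjecture.HodgeConjecture.Cruxes.H413.K2E1BorelEisensteinRegularCMThree
open Summit.HodgeConjecture.HodgeConjecture.Cruxes.H413.K2E1BorelEisensteinGodementCMTwo
open Summit.HodgeConjecture.HodgeConjecture.Cruxes.H413.K2E1EisensteinSeriesRegularity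

namespace Summit.HodgeConjecture.HodgeConjecture.Cruxes.H413.K2E1BorelEisensteinRegularU

section AnyN

variable {F E : Type} [Field F] [NumberField F] [Field E] [NumberField E] [Algebra F E] {c : E ≃ₐ[F] E} {N : ℕ} [NeZero N]

/-! ## §1 The `z`-uniform majorant from the height majorants -/

/-- **THE `z`-UNIFORM MAJORANT (any `N`)**: from height majorants for every `τ > τ₀`, for `τ₀ < σ₁ ≤ σ₂` and `‖φ‖ ≤ M` every `g₀` has a neighbourhood `U` and ONE summable `u` with
`‖f_z(γ̃_q g)‖ ≤ u q` for all `g ∈ U`, all `q`, all `z` with `σ₁ ≤ Re z ≤ σ₂` (`H^{Re z} ≤ H^{σ₁} + H^{σ₂}`, ★ `rpow_le_rpow_add_rpow`). [cite: MoeglinWaldspurger1995, II.1.5] [cite: Garrett2018, §2.8] -/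
theorem exists_nhds_uniform_majorant_flatSectionU {τ₀ : ℝ}
    (hmaj : ∀ τ : ℝ, τ₀ < τ → ∀ g₀ : (quasiSplit F E c N).Adelic, ∃ U ∈ 𝓝 g₀,
      ∃ u : Quotient (orbitRel ↥(borelU (c : E →+* E) ((StdForm.antidiagonal N).over E)) ↥(unitaryGroupOfForm (c : E →+* E) ((StdForm.antidiagonal N).over E))) → ℝ,
        Summable u ∧ ∀ g ∈ U, ∀ q,
          ((borelHeight ((quasiSplit F E c N).toAdelic (Quotient.out q : ↥(unitaryGroupOfForm (c : E →+* E) ((StdForm.antidiagonal N).over E))) * g) : ℝ)) ^ τ ≤ u q)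
    {σ₁ σ₂ : ℝ} (hσ₁ : τ₀ < σ₁) (hσ : σ₁ ≤ σ₂) {φ : (quasiSplit F E c N).Adelic → ℂ} {M : ℝ} (hφ : ∀ x, ‖φ x‖ ≤ M) (g₀ : (quasiSplit F E c N).Adelic) :
    ∃ U ∈ 𝓝 g₀, ∃ u : Quotient (orbitRel ↥(borelU (c : E →+* E) ((StdForm.antidiagonal N).over E)) ↥(unitaryGroupOfForm (c : E →+* E) ((StdForm.antidiagonal N).over E))) → ℝ,
      Summable u ∧ ∀ g ∈ U, ∀ q, ∀ z : ℂ, σ₁ ≤ z.re → z.re ≤ σ₂ →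
        ‖flatSectionU φ z ((quasiSplit F E c N).toAdelic (Quotient.out q : ↥(unitaryGroupOfForm (c : E →+* E) ((StdForm.antidiagonal N).over E))) * g)‖ ≤ u q := by
  obtain ⟨U₁, hU₁, u₁, hu₁, hle₁⟩ := hmaj σ₁ hσ₁ g₀
  obtain ⟨U₂, hU₂, u₂, hu₂, hle₂⟩ := hmaj σ₂ (hσ₁.trans_le hσ) g₀
  have hM : 0 ≤ M := (norm_nonneg _).trans (hφ 1)
  refine ⟨U₁ ∩ U₂, inter_mem hU₁ hU₂, fun q => M * (u₁ q + u₂ q), (hu₁.add hu₂).mul_left M, fun g hg q z hz₁ hz₂ => ?_⟩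
  rw [norm_flatSectionU]
  refine mul_le_mul (hφ _) ?_ (Real.rpow_nonneg (NNReal.coe_nonneg _) _) hM
  exact (rpow_le_rpow_add_rpow (by exact_mod_cast borelHeight_pos _) hz₁ hz₂).trans (add_le_add (hle₁ g hg.1 q) (hle₂ g hg.2 q))

/-! ## §2 Continuity in `g`, joint continuity, holomorphy in `z` -/

/-- **`g ↦ E(φ, z)(g)` IS CONTINUOUS** for `τ₀ < Re z`, `φ` continuous and bounded, given the height majorants (★ p09 `continuous_tsum_translate_left`).
[cite: MoeglinWaldspurger1995, II.1.5] [cite: Garrett2018, §2.8] -/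
theorem continuous_eisensteinSeriesU_flatSectionU {τ₀ : ℝ}
    (hmaj : ∀ τ : ℝ, τ₀ < τ → ∀ g₀ : (quasiSplit F E c N).Adelic, ∃ U ∈ 𝓝 g₀,
      ∃ u : Quotient (orbitRel ↥(borelU (c : E →+* E) ((StdForm.antidiagonal N).over E)) ↥(unitaryGroupOfForm (c : E →+* E) ((StdForm.antidiagonal N).over E))) → ℝ,
        Summable u ∧ ∀ g ∈ U, ∀ q,
          ((borelHeight ((quasiSplit F E c N).toAdelic (Quotient.out q : ↥(unitaryGroupOfForm (c : E →+* E) ((StdForm.antidiagonal N).over E))) * g) : ℝ)) ^ τ ≤ u q)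
    {z : ℂ} (hz : τ₀ < z.re) {φ : (quasiSplit F E c N).Adelic → ℂ} (hφc : Continuous φ) {M : ℝ} (hφ : ∀ x, ‖φ x‖ ≤ M) :
    Continuous fun g : (quasiSplit F E c N).Adelic => eisensteinSeriesU (flatSectionU φ z) g := by
  refine continuous_tsum_translate_left (continuous_flatSectionU hφc z) fun g₀ => ?_
  obtain ⟨U, hU, u, hu, hle⟩ := exists_nhds_uniform_majorant_flatSectionU hmaj hz le_rfl hφ g₀
  exact ⟨U, hU, u, hu, fun g hg q => hle g hg q z le_rfl le_rfl⟩

/-- `(z, x) ↦ f_z(x) = φ(x) · H(x)^z` is jointly continuous (`φ` continuous). [cite: MoeglinWaldspurger1995, II.1.5] -/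
theorem continuous_flatSectionU_uncurry {φ : (quasiSplit F E c N).Adelic → ℂ} (hφc : Continuous φ) :
    Continuous fun p : ℂ × (quasiSplit F E c N).Adelic => flatSectionU φ p.1 p.2 := by
  simp only [flatSectionU_apply]
  refine (hφc.comp continuous_snd).mul ?_
  have hH : Continuous fun p : ℂ × (quasiSplit F E c N).Adelic => ((borelHeight p.2 : ℝ) : ℂ) :=
    Complex.continuous_ofReal.comp (NNReal.continuous_coe.comp (continuous_borelHeight.comp continuous_snd))
  exact hH.cpow continuous_fst fun p => Or.inl (by rw [Complex.ofReal_re]; exact_mod_cast borelHeight_pos p.2)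

/-- **`(z, g) ↦ E(φ, z)(g)` IS JOINTLY CONTINUOUS ON `{z // τ₀ < Re z} × G(𝔸)`** (`φ` continuous bounded; §1 in ★ p09 `continuous_tsum_of_locallyUniformMajorant`).
[cite: MoeglinWaldspurger1995, II.1.5] [cite: Garrett2018, §2.8] -/
theorem continuous_eisensteinSeriesU_flatSectionU_uncurry {τ₀ : ℝ}
    (hmaj : ∀ τ : ℝ, τ₀ < τ → ∀ g₀ : (quasiSplit F E c N).Adelic, ∃ U ∈ 𝓝 g₀,
      ∃ u : Quotient (orbitRel ↥(borelU (c : E →+* E) ((StdForm.antidiagonal N).over E)) ↥(unitaryGroupOfForm (c : E →+* E) ((StdForm.antidiagonal N).over E))) → ℝ,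
        Summable u ∧ ∀ g ∈ U, ∀ q,
          ((borelHeight ((quasiSplit F E c N).toAdelic (Quotient.out q : ↥(unitaryGroupOfForm (c : E →+* E) ((StdForm.antidiagonal N).over E))) * g) : ℝ)) ^ τ ≤ u q)
    {φ : (quasiSplit F E c N).Adelic → ℂ} (hφc : Continuous φ) {M : ℝ} (hφ : ∀ x, ‖φ x‖ ≤ M) :
    Continuous fun p : {z : ℂ // τ₀ < z.re} × (quasiSplit F E c N).Adelic => eisensteinSeriesU (flatSectionU φ (p.1 : ℂ)) p.2 := by
  refine continuous_tsum_of_locallyUniformMajorant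
    (F := fun q (p : {z : ℂ // τ₀ < z.re} × (quasiSplit F E c N).Adelic) =>
      flatSectionU φ (p.1 : ℂ) ((quasiSplit F E c N).toAdelic (Quotient.out q : ↥(unitaryGroupOfForm (c : E →+* E) ((StdForm.antidiagonal N).over E))) * p.2))
    (fun q => (continuous_flatSectionU_uncurry hφc).comp ((continuous_subtype_val.comp continuous_fst).prodMk (continuous_const.mul continuous_snd))) fun p₀ => ?_
  set σ₁ : ℝ := (τ₀ + (p₀.1 : ℂ).re) / 2 with hσ₁
  set σ₂ : ℝ := (p₀.1 : ℂ).re + 1 with hσ₂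
  have h2σ₁ : τ₀ < σ₁ := by rw [hσ₁]; linarith [p₀.1.2]
  have hσ₁z : σ₁ < (p₀.1 : ℂ).re := by rw [hσ₁]; linarith [p₀.1.2]
  have hzσ₂ : (p₀.1 : ℂ).re < σ₂ := by rw [hσ₂]; linarith
  obtain ⟨U, hU, u, hu, hle⟩ := exists_nhds_uniform_majorant_flatSectionU hmaj h2σ₁ (hσ₁z.le.trans hzσ₂.le) hφ p₀.2
  have hstrip : {w : {z : ℂ // τ₀ < z.re} | σ₁ < (w : ℂ).re ∧ (w : ℂ).re < σ₂} ∈ 𝓝 p₀.1 :=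
    (isOpen_Ioo.preimage (Complex.continuous_re.comp continuous_subtype_val)).mem_nhds ⟨hσ₁z, hzσ₂⟩
  exact ⟨_, prod_mem_nhds hstrip hU, u, hu, fun p hp q => hle p.2 hp.2 q (p.1 : ℂ) hp.1.1.le hp.1.2.le⟩

/-- Each term `z ↦ f_z(x) = φ(x) · (H x)^z` is entire (positive real base). [cite: MoeglinWaldspurger1995, II.1.5] -/
theorem differentiable_flatSectionU_apply (φ : (quasiSplit F E c N).Adelic → ℂ) (x : (quasiSplit F E c N).Adelic) : Differentiable ℂ fun z : ℂ => flatSectionU φ z x := by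
  simp only [flatSectionU_apply]
  have hne : ((borelHeight x : ℝ) : ℂ) ≠ 0 := by exact_mod_cast (borelHeight_pos x).ne'
  exact fun z => (differentiableAt_const _).mul (differentiableAt_id.const_cpow (Or.inl hne))

/-- **`z ↦ E(φ, z)(g)` IS HOLOMORPHIC ON `{z | τ₀ < Re z}`** for every bounded `φ` and every `g`, given the height majorants (§1 at fixed `g`; ★ p09 `differentiableOn_tsum_param`).
[cite: MoeglinWaldspurger1995, II.1.5] [cite: Garrett2018, §2.8] [cite: Godement1964, §8] -/
theorem differentiableOn_eisensteinSeriesU_flatSectionU {τ₀ : ℝ}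
    (hmaj : ∀ τ : ℝ, τ₀ < τ → ∀ g₀ : (quasiSplit F E c N).Adelic, ∃ U ∈ 𝓝 g₀,
      ∃ u : Quotient (orbitRel ↥(borelU (c : E →+* E) ((StdForm.antidiagonal N).over E)) ↥(unitaryGroupOfForm (c : E →+* E) ((StdForm.antidiagonal N).over E))) → ℝ,
        Summable u ∧ ∀ g ∈ U, ∀ q,
          ((borelHeight ((quasiSplit F E c N).toAdelic (Quotient.out q : ↥(unitaryGroupOfForm (c : E →+* E) ((StdForm.antidiagonal N).over E))) * g) : ℝ)) ^ τ ≤ u q)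
    {φ : (quasiSplit F E c N).Adelic → ℂ} {M : ℝ} (hφ : ∀ x, ‖φ x‖ ≤ M) (g : (quasiSplit F E c N).Adelic) :
    DifferentiableOn ℂ (fun z : ℂ => eisensteinSeriesU (flatSectionU φ z) g) {z : ℂ | τ₀ < z.re} := by
  refine differentiableOn_tsum_param (isOpen_lt continuous_const Complex.continuous_re) g
    (F := fun q (z : ℂ) (g : (quasiSplit F E c N).Adelic) =>
      flatSectionU φ z ((quasiSplit F E c N).toAdelic (Quotient.out q : ↥(unitaryGroupOfForm (c : E →+* E) ((StdForm.antidiagonal N).over E))) * g))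
    (fun q => (differentiable_flatSectionU_apply φ _).differentiableOn) fun z₀ hz₀ => ?_
  set σ₁ : ℝ := (τ₀ + z₀.re) / 2 with hσ₁
  set σ₂ : ℝ := z₀.re + 1 with hσ₂
  have hz₀' : τ₀ < z₀.re := hz₀
  have h2σ₁ : τ₀ < σ₁ := by rw [hσ₁]; linarith
  have hσ₁z : σ₁ < z₀.re := by rw [hσ₁]; linarith
  have hzσ₂ : z₀.re < σ₂ := by rw [hσ₂]; linarith
  obtain ⟨U, hU, u, hu, hle⟩ := exists_nhds_uniform_majorant_flatSectionU hmaj h2σ₁ (hσ₁z.le.trans hzσ₂.le) hφ g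
  exact ⟨{w : ℂ | σ₁ < w.re ∧ w.re < σ₂}, (isOpen_Ioo.preimage Complex.continuous_re).mem_nhds ⟨hσ₁z, hzσ₂⟩, u, hu,
    fun w hw q => hle g (mem_of_mem_nhds hU) q w hw.1.le hw.2.le⟩

end AnyN

/-! ## §3 `N = 2` over a CM field: unconditional on `Re z > 1` -/

section CMTwo

variable (L : Type) [Field L] [NumberField L] [IsCMField L]

/-- **`g ↦ E(φ, z)(g)` IS CONTINUOUS on `U(J₂)(𝔸_{L⁺})`** for `Re z > 1`, `φ` continuous and bounded — unconditional. [cite: MoeglinWaldspurger1995, II.1.5] [cite: Garrett2018, §2.8] -/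
theorem continuous_eisensteinSeriesU_flatSectionU_cm_two {z : ℂ} (hz : 1 < z.re)
    {φ : (quasiSplit (↥(maximalRealSubfield L)) L (IsCMField.complexConj L) 2).Adelic → ℂ} (hφc : Continuous φ) {M : ℝ} (hφ : ∀ x, ‖φ x‖ ≤ M) :
    Continuous fun g : (quasiSplit (↥(maximalRealSubfield L)) L (IsCMField.complexConj L) 2).Adelic => eisensteinSeriesU (flatSectionU φ z) g :=
  continuous_eisensteinSeriesU_flatSectionU (fun _ hτ g₀ => exists_nhds_summable_majorant_borelHeight_rpow_cm_two L hτ g₀) hz hφc hφ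

/-- **JOINT CONTINUITY of `(z, g) ↦ E(φ, z)(g)` on `{z // 1 < Re z} × U(J₂)(𝔸_{L⁺})`** — unconditional. [cite: MoeglinWaldspurger1995, II.1.5] [cite: Garrett2018, §2.8] -/
theorem continuous_eisensteinSeriesU_flatSectionU_uncurry_cm_two
    {φ : (quasiSplit (↥(maximalRealSubfield L)) L (IsCMField.complexConj L) 2).Adelic → ℂ} (hφc : Continuous φ) {M : ℝ} (hφ : ∀ x, ‖φ x‖ ≤ M) :
    Continuous fun p : {z : ℂ // (1 : ℝ) < z.re} × (quasiSplit (↥(maximalRealSubfield L)) L (IsCMField.complexConj L) 2).Adelic =>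
      eisensteinSeriesU (flatSectionU φ (p.1 : ℂ)) p.2 :=
  continuous_eisensteinSeriesU_flatSectionU_uncurry (fun _ hτ g₀ => exists_nhds_summable_majorant_borelHeight_rpow_cm_two L hτ g₀) hφc hφ

/-- **HOLOMORPHY of `z ↦ E(φ, z)(g)` on `{z | 1 < Re z}` for `U(J₂)` over a CM field**, every bounded `φ`, every `g` — unconditional; the 5Res rails. [cite: MoeglinWaldspurger1995, II.1.5]
[cite: Garrett2018, §2.8] [cite: Godement1964, §8] -/
theorem differentiableOn_eisensteinSeriesU_flatSectionU_cm_two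
    {φ : (quasiSplit (↥(maximalRealSubfield L)) L (IsCMField.complexConj L) 2).Adelic → ℂ} {M : ℝ} (hφ : ∀ x, ‖φ x‖ ≤ M)
    (g : (quasiSplit (↥(maximalRealSubfield L)) L (IsCMField.complexConj L) 2).Adelic) :
    DifferentiableOn ℂ (fun z : ℂ => eisensteinSeriesU (flatSectionU φ z) g) {z : ℂ | (1 : ℝ) < z.re} :=
  differentiableOn_eisensteinSeriesU_flatSectionU (fun _ hτ g₀ => exists_nhds_summable_majorant_borelHeight_rpow_cm_two L hτ g₀) hφ g

end CMTwo

end Summit.HodgeConjecture.HodgeConjecture.Cruxes.H413.K2E1BorelEisensteinRegularU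

end
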